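import Summits.HodgeConjecture.CorCM.Census.OcticTwistReduction
import Summits.HodgeConjecture.CorCM.Census.QuarticTwistResidualStructure

/-!
# The octic twist `(ℤ/8 × B, (4,0))`, VI: RESIDUAL PREPARATIONS — the quartic residual theorem with residual pairs only; the
# constant-constant squares from the Weil lifts and the D-moves

COR-CM (cell `pub-hodgecm2`), count-neutral kernel combinatorics by the binder seat b09 (gen 33; lane COINVARIANT-TWIST / OCTIC RECON, first
lemmas of design step 3 of `HOME/pub-hodgecm2-b09/lean-g33/COINVARIANT-TWIST.md` PART C), on top of parts I–V (`Census/OcticTwist*.lean`) and the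
quartic residual files (`Census/QuarticTwistResidual.lean`: `Xvec`, `Wvec`, `IsRes1`, `atom_add_two`; `Census/QuarticTwistResidualStructure.lean`:
**`residual_mem`**) used BY NAME.  Theorems only (no definition, no `decide` beyond closed numerals of `ZMod 4`, no certificate, no named fact,
no `sorry`).  HONEST FRAMING: `HC_CM` is NOT proved; nothing here is a period or a headline.

CONTENT.
* §1 **`residual_mem'`** — the quartic RESIDUAL THEOREM (`|B| ≥ 3`: a quartic Hodge vector supported on the small residual types lies in any
  submodule containing the pairs, the `X_{u,b}` and the `w_u`) with the pairs hypothesis WEAKENED to the pairs THROUGH SMALL RESIDUAL TYPES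
  (`pairVec s ∈ N` for `IsRes1 s` only).  No copy of the proof: `residual_mem` is applied to the pull-back `{v | π v ∈ N}` of `N` under the
  restriction `π` to the small residual types (`restrictRes`), which contains every pair (`π (e_s + e_{s+2})` is the pair or `0`, the small
  residual types being stable under `+2`) and fixes `X`, `w` and the vector itself.  This is the form the octic slices need: in a slice
  `{v | v ⊗ e_{cst u′} ∈ N₂}` only the RESIDUAL quartic pairs are available (as D-moves plus constant-constant corrections, lane note PART C (iii)).
* §2 **constant-constant squares**: if `N₂` contains the Weil lifts `w_u ⊗ e_{cst u′}` and the D-moves `(e_{u−δ_b} − e_u) ⊗ (e_{cst u′} − e_{cst u″})`,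
  it contains **`(e_{cst u} − e_{cst (u−1)}) ⊗ (e_{cst u′} − e_{cst u″})`** (`ccSquare_mem`; `w_u = Σ_b (e_{u−δ_b} − e_u) + (e_u − e_{u−1})`), hence by
  telescoping `(e_{cst u} − e_{cst 0}) ⊗ (e_{cst u′} − e_{cst u″})` (`ccSquare₀_mem`) and, with the swap-twisted hypotheses, the transposed squares —
  the generators of the bi-marginal-zero constant-constant vectors (lane note PART C (iv)).

## References
* [Pohlmann1968] H. Pohlmann, Algebraic cycles on abelian varieties of complex multiplication type, Ann. of Math. 88 (1968), Thm 1.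
* [Milne1999] J. S. Milne, Lefschetz motives and the Tate conjecture, Compositio Math. 117 (1999), Prop. 2.1, p. 54.
-/

namespace Summit.HodgeConjecture.CorCM.Census.OcticTwist

open Finset
open Summit.HodgeConjecture.CorCM.Census.QuarticTwist

variable (B : Type) [AddGroup B] [Fintype B] [DecidableEq B]

/-! ## §1 The quartic residual theorem with residual pairs only -/

section Quartic

open Classical in
/-- Restriction of a quartic exponent vector to the small residual types. [folklore] -/
noncomputable def restrictRes : (Ty B → ℤ) →ₗ[ℤ] (Ty B → ℤ) where
  toFun v := fun s => if IsRes1 B s then v s else 0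
  map_add' v w := by
    funext s
    simp only [Pi.add_apply]
    split_ifs <;> simp
  map_smul' c v := by
    funext s
    simp only [Pi.smul_apply, smul_eq_mul, RingHom.id_apply]
    split_ifs <;> simp

open Classical in
omit [Fintype B] [AddGroup B] in
/-- Values of the restriction. [folklore] -/
theorem restrictRes_apply (v : Ty B → ℤ) (s : Ty B) : restrictRes B v s = if IsRes1 B s then v s else 0 := rfl

omit [Fintype B] [AddGroup B] in
/-- A vector supported on the small residual types is its own restriction. [folklore] -/
theorem restrictRes_eq_self {v : Ty B → ℤ} (hv : ∀ s, v s ≠ 0 → IsRes1 B s) : restrictRes B v = v := by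
  funext s
  rw [restrictRes_apply]
  split_ifs with h
  · rfl
  · by_contra hne
    exact h (hv s (Ne.symm hne))

omit [Fintype B] [AddGroup B] in
/-- The small residual types are stable under `+2`. [folklore] -/
theorem isRes1_add_two {s : Ty B} (hs : IsRes1 B s) : IsRes1 B (s + 2) := by
  obtain ⟨u, b, k, hk, rfl⟩ := hs
  exact ⟨u + 2, b, k, hk, atom_add_two B u b k⟩

omit [Fintype B] [AddGroup B] in
/-- … and under `−2` (the same thing). [folklore] -/
theorem isRes1_of_add_two {s : Ty B} (hs : IsRes1 B (s + 2)) : IsRes1 B s := by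
  have h := isRes1_add_two B hs
  have e : s + 2 + 2 = s := by
    rw [add_assoc]
    show s + ((2 : Ty B) + 2) = s
    have h4 : ((2 : Ty B) + 2) = 0 := by
      funext b
      show (2 : ZMod 4) + 2 = 0
      decide
    rw [h4, add_zero]
  rwa [e] at h

omit [AddGroup B] in
/-- **The restriction of a pair is the pair or zero.** [folklore] -/
theorem restrictRes_pairVec (s : Ty B) : restrictRes B (pairVec B s) = pairVec B s ∨ restrictRes B (pairVec B s) = 0 := by
  classical
  by_cases hs : IsRes1 B s
  · left
    refine restrictRes_eq_self B fun t ht => ?_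
    unfold pairVec at ht
    rw [Pi.add_apply, Pi.single_apply, Pi.single_apply] at ht
    by_cases h1 : t = s
    · rw [h1]; exact hs
    · by_cases h2 : t = s + 2
      · rw [h2]; exact isRes1_add_two B hs
      · rw [if_neg h1, if_neg h2, add_zero] at ht
        exact (ht rfl).elim
  · right
    funext t
    rw [restrictRes_apply, Pi.zero_apply]
    split_ifs with ht
    · unfold pairVec
      rw [Pi.add_apply, Pi.single_apply, Pi.single_apply, if_neg, if_neg, add_zero]
      · intro h2
        rw [h2] at ht
        exact hs (isRes1_of_add_two B ht)
      · intro h1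
        rw [h1] at ht
        exact hs ht
    · rfl

omit [AddGroup B] in
/-- `X_{u,b}` is supported on the small residual types. [folklore] -/
theorem restrictRes_Xvec (u : ZMod 4) (b : B) : restrictRes B (Xvec B u b) = Xvec B u b := by
  refine restrictRes_eq_self B fun t ht => ?_
  unfold Xvec at ht
  simp only [Pi.add_apply, Pi.sub_apply, Pi.single_apply] at ht
  by_cases h1 : t = atom B u b 1
  · exact ⟨u, b, 1, Or.inr (Or.inl rfl), h1⟩
  by_cases h2 : t = atom B (u + 1) b (-1)
  · exact ⟨u + 1, b, -1, Or.inr (Or.inr rfl), h2⟩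
  by_cases h3 : t = cst B u
  · exact ⟨u, b, 0, Or.inl rfl, by rw [h3, atom_zero]⟩
  by_cases h4 : t = cst B (u + 1)
  · exact ⟨u + 1, b, 0, Or.inl rfl, by rw [h4, atom_zero]⟩
  rw [if_neg h1, if_neg h2, if_neg h3, if_neg h4] at ht
  exact (ht (by ring)).elim

omit [AddGroup B] in
/-- `w_u` is supported on the small residual types. [folklore] -/
theorem restrictRes_Wvec [Nonempty B] (u : ZMod 4) : restrictRes B (Wvec B u) = Wvec B u := by
  refine restrictRes_eq_self B fun t ht => ?_
  by_contra hres
  apply ht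
  unfold Wvec
  simp only [Pi.sub_apply, Pi.smul_apply, Finset.sum_apply, Pi.single_apply, smul_eq_mul]
  have h1 : ∀ b : B, t ≠ atom B u b (-1) := fun b h => hres ⟨u, b, -1, Or.inr (Or.inr rfl), h⟩
  have h2 : t ≠ cst B u := fun h => hres ⟨u, Classical.arbitrary B, 0, Or.inl rfl, by rw [h, atom_zero]⟩
  have h3 : t ≠ cst B (u - 1) := fun h => hres ⟨u - 1, Classical.arbitrary B, 0, Or.inl rfl, by rw [h, atom_zero]⟩
  rw [Finset.sum_eq_zero (fun b _ => if_neg (h1 b)), if_neg h2, if_neg h3]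
  ring

omit [AddGroup B] in
/-- **THE QUARTIC RESIDUAL THEOREM WITH RESIDUAL PAIRS ONLY** (`|B| ≥ 3`): a quartic Hodge vector supported on the small residual types lies in
every submodule containing the pairs THROUGH SMALL RESIDUAL TYPES, the `X_{u,b}` and the `w_u`. [folklore] -/
theorem residual_mem' (h3 : 3 ≤ Fintype.card B) {N : Submodule ℤ (Ty B → ℤ)} (hP : ∀ s : Ty B, IsRes1 B s → pairVec B s ∈ N)
    (hX : ∀ (u : ZMod 4) (b : B), Xvec B u b ∈ N) (hW : ∀ u : ZMod 4, Wvec B u ∈ N) {r : Ty B → ℤ} (hr : r ∈ hodge B)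
    (hsupp : ∀ s, r s ≠ 0 → IsRes1 B s) : r ∈ N := by
  haveI : Nonempty B := Fintype.card_pos_iff.mp (by omega)
  have key : r ∈ N.comap (restrictRes B) := by
    refine residual_mem B h3 (N := N.comap (restrictRes B)) ?_ ?_ ?_ hr hsupp
    · refine Submodule.span_le.mpr ?_
      rintro _ ⟨s, rfl⟩
      show restrictRes B (pairVec B s) ∈ N
      rcases restrictRes_pairVec B s with h | h
      · rw [h]
        by_cases hs : IsRes1 B s
        · exact hP s hs
        · exfalso
          have h' := congrFun h s
          rw [restrictRes_apply, if_neg hs] at h'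
          unfold pairVec at h'
          rw [Pi.add_apply, Pi.single_eq_same, Pi.single_apply] at h'
          split_ifs at h' with h2
          · omega
          · omega
      · rw [h]
        exact Submodule.zero_mem _
    · intro u b
      show restrictRes B (Xvec B u b) ∈ N
      rw [restrictRes_Xvec]
      exact hX u b
    · intro u
      show restrictRes B (Wvec B u) ∈ N
      rw [restrictRes_Wvec]
      exact hW u
  have h := (Submodule.mem_comap.mp key)
  rwa [restrictRes_eq_self B hsupp] at h

end Quartic

/-! ## §2 Constant-constant squares from the Weil lifts and the D-moves -/

omit [AddGroup B] in
/-- The Weil vector as «atoms minus their constant» plus a constant-constant difference: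
`w_u = Σ_b (e_{u−δ_b} − e_u) + (e_u − e_{u−1})`. [folklore] -/
theorem Wvec_eq_sum (u : ZMod 4) :
    Wvec B u = ∑ b : B, (Pi.single (atom B u b (-1)) 1 - Pi.single (cst B u) 1) + (Pi.single (cst B u) 1 - Pi.single (cst B (u - 1)) 1) := by
  funext s
  unfold Wvec
  simp only [Finset.sum_apply, Pi.add_apply, Pi.sub_apply, Pi.smul_apply, smul_eq_mul]
  rw [Finset.sum_sub_distrib, Finset.sum_const, Finset.card_univ, nsmul_eq_mul]
  ring

omit [AddGroup B] [DecidableEq B] [Fintype B] in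
/-- `tens` is additive over finite sums in the first factor. [folklore] -/
theorem tens_sum_left {ι : Type} (S : Finset ι) (f : ι → Ty B → ℤ) (w : Ty B → ℤ) :
    tens B (∑ i ∈ S, f i) w = ∑ i ∈ S, tens B (f i) w := by
  funext T
  rw [Finset.sum_apply]
  show (∑ i ∈ S, f i) T.1 * w T.2 = ∑ i ∈ S, f i T.1 * w T.2
  rw [Finset.sum_apply, Finset.sum_mul]

omit [AddGroup B] in
/-- **Constant-constant squares**: `(e_{cst u} − e_{cst (u−1)}) ⊗ (e_{cst u′} − e_{cst u″}) ∈ N₂` as soon as `N₂` contains the Weil lifts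
`w_u ⊗ e_{cst u′}`, `w_u ⊗ e_{cst u″}` and the D-moves `(e_{u−δ_b} − e_u) ⊗ (e_{cst u′} − e_{cst u″})`. [folklore] -/
theorem ccSquare_mem {N₂ : Submodule ℤ (Ty₂ B → ℤ)} (u u' u'' : ZMod 4)
    (hW' : tens B (Wvec B u) (Pi.single (cst B u') 1) ∈ N₂) (hW'' : tens B (Wvec B u) (Pi.single (cst B u'') 1) ∈ N₂)
    (hD : ∀ b : B, tens B (Pi.single (atom B u b (-1)) 1 - Pi.single (cst B u) 1) (Pi.single (cst B u') 1 - Pi.single (cst B u'') 1) ∈ N₂) :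
    tens B (Pi.single (cst B u) 1 - Pi.single (cst B (u - 1)) 1) (Pi.single (cst B u') 1 - Pi.single (cst B u'') 1) ∈ N₂ := by
  have hWd : tens B (Wvec B u) (Pi.single (cst B u') 1 - Pi.single (cst B u'') 1) ∈ N₂ := by
    rw [tens_sub_right]
    exact Submodule.sub_mem _ hW' hW''
  have e : tens B (Pi.single (cst B u) 1 - Pi.single (cst B (u - 1)) 1) (Pi.single (cst B u') 1 - Pi.single (cst B u'') 1) =
      tens B (Wvec B u) (Pi.single (cst B u') 1 - Pi.single (cst B u'') 1) -
        ∑ b : B, tens B (Pi.single (atom B u b (-1)) 1 - Pi.single (cst B u) 1) (Pi.single (cst B u') 1 - Pi.single (cst B u'') 1) := by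
    rw [Wvec_eq_sum, tens_add_left, tens_sum_left, eq_sub_iff_add_eq, add_comm]
  rw [e]
  exact Submodule.sub_mem _ hWd (Submodule.sum_mem _ fun b _ => hD b)

omit [AddGroup B] [DecidableEq B] in
/-- **Telescoped constant-constant squares**: `(e_{cst u} − e_{cst 0}) ⊗ d ∈ N₂` for `d = e_{cst u′} − e_{cst u″}`, from the unit steps
`(e_{cst v} − e_{cst (v−1)}) ⊗ d ∈ N₂`. [folklore] -/
theorem ccSquare₀_mem {N₂ : Submodule ℤ (Ty₂ B → ℤ)} (u' u'' : ZMod 4)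
    (hstep : ∀ v : ZMod 4,
      tens B (Pi.single (cst B v) 1 - Pi.single (cst B (v - 1)) 1) (Pi.single (cst B u') 1 - Pi.single (cst B u'') 1) ∈ N₂) (u : ZMod 4) :
    tens B (Pi.single (cst B u) 1 - Pi.single (cst B 0) 1) (Pi.single (cst B u') 1 - Pi.single (cst B u'') 1) ∈ N₂ := by
  -- the four values of `u`, by telescoping
  have tele : ∀ v : ZMod 4, tens B (Pi.single (cst B v) 1 - Pi.single (cst B 0) 1) (Pi.single (cst B u') 1 - Pi.single (cst B u'') 1) ∈ N₂ →
      tens B (Pi.single (cst B (v + 1)) 1 - Pi.single (cst B 0) 1) (Pi.single (cst B u') 1 - Pi.single (cst B u'') 1) ∈ N₂ := by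
    intro v hv
    have h := hstep (v + 1)
    rw [add_sub_cancel_right] at h
    have e : tens B (Pi.single (cst B (v + 1)) 1 - Pi.single (cst B 0) 1) (Pi.single (cst B u') 1 - Pi.single (cst B u'') 1) =
        tens B (Pi.single (cst B (v + 1)) 1 - Pi.single (cst B v) 1) (Pi.single (cst B u') 1 - Pi.single (cst B u'') 1) +
          tens B (Pi.single (cst B v) 1 - Pi.single (cst B 0) 1) (Pi.single (cst B u') 1 - Pi.single (cst B u'') 1) := by
      rw [← tens_add_left, sub_add_sub_cancel]
    rw [e]
    exact Submodule.add_mem _ h hv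
  have h0 : tens B (Pi.single (cst B 0) 1 - Pi.single (cst B 0) 1) (Pi.single (cst B u') 1 - Pi.single (cst B u'') 1) ∈ N₂ := by
    rw [sub_self]
    have e : tens B (0 : Ty B → ℤ) (Pi.single (cst B u') 1 - Pi.single (cst B u'') 1) = 0 := by
      funext T
      show (0 : ℤ) * _ = 0
      rw [zero_mul]
    rw [e]
    exact Submodule.zero_mem _
  have h1 := tele 0 h0
  have h2 := tele _ h1
  have h3 := tele _ h2
  have key : ∀ v : ZMod 4, v = 0 ∨ v = 0 + 1 ∨ v = 0 + 1 + 1 ∨ v = 0 + 1 + 1 + 1 := by decide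
  rcases key u with rfl | rfl | rfl | rfl
  · exact h0
  · exact h1
  · exact h2
  · exact h3

end Summit.HodgeConjecture.CorCM.Census.OcticTwist
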